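import Summits.BirchSwinnertonDyer.BirchSwinnertonDyer.Theorems.PrintCf2RubinValueTwoRayClassNumberFormula
import Mathlib.RingTheory.ZMod.UnitsCyclic
import HarnessLib

/-!
# `Cl_K^{v^{n+1}}` and `Gal(K(v^{n+1})/K)` are CYCLIC (of order `2^{n-1}`) for `K = ℚ(√-7)`, `2 = v v̄`
# — the `𝔣 = 1` division tower at a split `2` is a cyclic `2`-tower

Summit `BirchSwinnertonDyer`, cell `bsd-print-cf2`; width seat `bsd-line-cf2-p1-w3` g19, idle-width item
(M9) B2-GLOBAL-SPLIT, STAGE 6 sequel (planner g20 13:46:07Z: «and, if free, `Gal(K(𝔣𝔭^{n+1})/K(𝔣𝔭))`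
cyclic or at least of exponent dividing `2^n` — say which you get»).  ANSWER: at `𝔣 = 1`, `K = ℚ(√-7)`:
CYCLIC.  With `h_K = 1` the unit-side map `(𝓞/𝔪)ˣ → Cl_K^𝔪` of Neukirch VI (1.11) is ONTO with kernel
the global units `{±1}` (`…RayClassNumberFormula`), and `(𝓞/v^{n+1})ˣ ≅ (ℤ/2^{n+1})ˣ = ⟨-1⟩ × ⟨5⟩`
(Gauss), so `Cl_K^{v^{n+1}} ≅ (ℤ/2^{n+1})ˣ/⟨-1⟩ ≅ ⟨5⟩` is cyclic of order `2^{n-1}`; by Artin reciprocity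
(`rayClassField_galEquivRayClassGroup`) so is `Gal(K(v^{n+1})/K)`.  HONEST FRAMING: generic algebraic
number theory / group theory; no summit statement is proved here, no stub is closed, BSD is not proved by
any of this.

## What is here (theorems only; no definition, no named fact, no `sorry`)

* §1 `(ℤ/2^{m+2})ˣ = ⟨5, -1⟩`: `ZModTwoPow.neg_one_not_mem_zpowers_five` (`-1 ∉ ⟨5⟩`, reduction mod `4`),
  `ZModTwoPow.zpowers_five_sup_zpowers_neg_one_eq_top`, ★ `ZModTwoPow.isCyclic_of_surjective_of_map_neg_one`
  (every quotient of `(ℤ/2^k)ˣ` killing `-1` is cyclic, all `k`).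
* §2 (`K` totally complex, `h_K = 1`, `𝔪 ≠ 0`): ★ `exists_surjective_unitsQuot_hom_of_classNumber_eq_one` —
  `Cl_K^𝔪` is a quotient of `(𝓞/𝔪)ˣ` by the image of `𝓞ˣ` (Neukirch VI (1.11) with `Cl_K = 1`).
* §3 (`K` imaginary quadratic, `d_K = -7`, `2 = v v̄`): ★★ `isCyclic_rayClassGroup_pow_succ_of_discr_eq_neg_seven`
  (`Cl_K^{v^{n+1}}` cyclic, all `n`), ★★ `isCyclic_gal_rayClassField_pow_succ_of_discr_eq_neg_seven`
  (`Gal(K(v^{n+1})/K)` cyclic) and `natCard_gal_rayClassField_pow_succ_of_discr_eq_neg_seven` (its order is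
  `2^{n-1}`, `n ≥ 1`).

References: J. Neukirch, *Algebraic Number Theory* (1999), Ch. VI §1 Prop. (1.11); C. F. Gauss,
*Disquisitiones* art. 90–91 (`(ℤ/2^k)ˣ = ⟨-1, 5⟩`) as in K. Ireland, M. Rosen, *A Classical Introduction to
Modern Number Theory*, Ch. 4 §1 Thm. 2′; E. de Shalit (1987) II.1.9 [deShalit1987].
-/

noncomputable section

-- summit-side namespace `Summit.BirchSwinnertonDyer.BirchSwinnertonDyer.…` (single-conjunct summit, D-0017 layout)
set_option linter.dupNamespace false
set_option autoImplicit false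

open scoped Classical nonZeroDivisors
open NumberField IsDedekindDomain IsDedekindDomain.HeightOneSpectrum
open Literature.NumberTheory.GaloisRepresentations Literature.NumberTheory.LFunctions
open Summit.BirchSwinnertonDyer.BirchSwinnertonDyer.Theorems.PrintCFram.HerbrandRayClassDevissage

namespace Summit.BirchSwinnertonDyer.BirchSwinnertonDyer.Theorems.PrintCf2.RayClassNumberFormula

/-! ### §1 `(ℤ/2^{m+2})ˣ` is generated by `5` and `-1`; quotients killing `-1` are cyclic -/

namespace ZModTwoPow

/-- `5` as a unit of `ℤ/2^k`. [folklore] -/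
theorem isUnit_five (k : ℕ) : IsUnit (5 : ZMod (2 ^ k)) := by
  have h : ((5 : ℕ) : ZMod (2 ^ k)) = 5 := by norm_cast
  rw [← h, ZMod.isUnit_iff_coprime]
  exact Nat.Coprime.pow_right k (by norm_num)

/-- **`-1 ∉ ⟨5⟩` in `(ℤ/2^{m+2})ˣ`**: every power of `5` is `≡ 1 (mod 4)`, `-1` is not.
[cite: IrelandRosen1990, Ch. 4 §1 Thm. 2'] -/
theorem neg_one_not_mem_zpowers_five (m : ℕ) :
    (-1 : (ZMod (2 ^ (m + 2)))ˣ) ∉ Subgroup.zpowers (isUnit_five (m + 2)).unit := by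
  intro h
  rw [(isOfFinOrder_of_finite _).mem_zpowers_iff_mem_range_orderOf] at h
  obtain ⟨i, -, hi⟩ := Finset.mem_image.mp h
  have hval : ((isUnit_five (m + 2)).unit ^ i : (ZMod (2 ^ (m + 2)))ˣ).val = (-1 : (ZMod (2 ^ (m + 2)))ˣ).val := by
    rw [hi]
  rw [Units.val_pow_eq_pow_val, IsUnit.unit_spec, Units.val_neg, Units.val_one] at hval
  have hdvd : 4 ∣ 2 ^ (m + 2) := ⟨2 ^ m, by ring⟩
  have h4 := congrArg (ZMod.castHom hdvd (ZMod 4)) hval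
  rw [map_pow, map_neg, map_one] at h4
  have h5 : ZMod.castHom hdvd (ZMod 4) (5 : ZMod (2 ^ (m + 2))) = 1 := by
    have : ((5 : ℕ) : ZMod (2 ^ (m + 2))) = 5 := by norm_cast
    rw [← this, map_natCast]
    decide
  rw [h5, one_pow] at h4
  exact absurd h4 (by decide)

/-- **`(ℤ/2^{m+2})ˣ = ⟨5⟩ · ⟨-1⟩`** (Gauss): `⟨5⟩` has order `2^m` (Mathlib `ZMod.orderOf_five`), hence index `2`
in the group of order `2^{m+1}`, and `-1 ∉ ⟨5⟩`. [cite: IrelandRosen1990, Ch. 4 §1 Thm. 2'] -/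
theorem zpowers_five_sup_zpowers_neg_one_eq_top (m : ℕ) :
    Subgroup.zpowers (isUnit_five (m + 2)).unit ⊔ Subgroup.zpowers (-1 : (ZMod (2 ^ (m + 2)))ˣ) = ⊤ := by
  set g : (ZMod (2 ^ (m + 2)))ˣ := (isUnit_five (m + 2)).unit with hg
  set H : Subgroup (ZMod (2 ^ (m + 2)))ˣ := Subgroup.zpowers g with hH
  -- `#⟨5⟩ = 2^m`, `#(ℤ/2^{m+2})ˣ = 2^{m+1}`, so `[G : ⟨5⟩] = 2`
  have hordg : orderOf g = 2 ^ m := by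
    rw [← orderOf_units, hg, IsUnit.unit_spec]
    exact ZMod.orderOf_five m
  have hcardH : Nat.card H = 2 ^ m := by rw [hH, Nat.card_zpowers, hordg]
  have hcardG : Nat.card (ZMod (2 ^ (m + 2)))ˣ = 2 ^ (m + 1) := by
    rw [Nat.card_eq_fintype_card, ZMod.card_units_eq_totient, Nat.totient_prime_pow Nat.prime_two (by omega)]
    simp
  have hidx : H.index = 2 := by
    have h := Subgroup.index_mul_card H
    rw [hcardH, hcardG] at h
    have h' : H.index * 2 ^ m = 2 * 2 ^ m := by rw [h]; ring
    exact Nat.eq_of_mul_eq_mul_right (pow_pos two_pos m) h'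
  -- a subgroup strictly above an index-`2` subgroup is everything
  have hle : H ≤ H ⊔ Subgroup.zpowers (-1) := le_sup_left
  have hrel := Subgroup.relIndex_mul_index hle
  rw [hidx] at hrel
  have hdvd : (H ⊔ Subgroup.zpowers (-1)).index ∣ 2 := ⟨_, hrel.symm.trans (mul_comm _ _)⟩
  rcases (Nat.dvd_prime Nat.prime_two).mp hdvd with h1 | h2
  · exact Subgroup.index_eq_one.mp h1
  · exfalso
    rw [h2] at hrel
    have hr1 : H.relIndex (H ⊔ Subgroup.zpowers (-1)) = 1 := by omega
    have hle' : H ⊔ Subgroup.zpowers (-1) ≤ H := Subgroup.relIndex_eq_one.mp hr1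
    exact neg_one_not_mem_zpowers_five m (hle' (Subgroup.mem_sup_right (Subgroup.mem_zpowers _)))

/-- ★ **Every quotient of `(ℤ/2^k)ˣ` in which `-1` dies is cyclic** (generated by the image of `5`).
[cite: IrelandRosen1990, Ch. 4 §1 Thm. 2'] -/
theorem isCyclic_of_surjective_of_map_neg_one {k : ℕ} {Q : Type*} [Group Q]
    (π : (ZMod (2 ^ k))ˣ →* Q) (hπ : Function.Surjective π) (h1 : π (-1) = 1) : IsCyclic Q := by
  rcases Nat.lt_or_ge k 2 with hk | hk
  · -- `k ≤ 1`... and `k = ` : `(ℤ/2^k)ˣ` is cyclic, hence so is its quotient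
    haveI : IsCyclic (ZMod (2 ^ k))ˣ := (ZMod.isCyclic_units_two_pow_iff k).mpr (by omega)
    exact isCyclic_of_surjective π hπ
  · obtain ⟨m, rfl⟩ : ∃ m, k = m + 2 := ⟨k - 2, by omega⟩
    refine isCyclic_iff_exists_zpowers_eq_top.mpr ⟨π (isUnit_five (m + 2)).unit, ?_⟩
    rw [← MonoidHom.map_zpowers, eq_top_iff, ← MonoidHom.range_eq_top.mpr hπ, MonoidHom.range_eq_map,
      ← zpowers_five_sup_zpowers_neg_one_eq_top m, Subgroup.map_sup, MonoidHom.map_zpowers, MonoidHom.map_zpowers, h1,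
      Subgroup.zpowers_one_eq_bot, sup_bot_eq]

end ZModTwoPow

/-! ### §2 `h_K = 1`: `Cl_K^𝔪` is a quotient of `(𝓞/𝔪)ˣ` by the global units -/

variable {K : Type*} [Field K] [NumberField K] {𝔪 : Ideal (𝓞 K)}

/-- ★ **For a totally complex `K` of class number one, `(𝓞/𝔪)ˣ → Cl_K^𝔪` is ONTO with kernel the image of
`𝓞_Kˣ`**: `Cl_K^𝔪 ≅ (𝓞/𝔪)ˣ / im(𝓞ˣ)` (Neukirch VI (1.11) with `Cl_K = 1`).
[cite: NeukirchANT1999, Ch. VI §1 Prop. (1.11)] -/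
theorem exists_surjective_unitsQuot_hom_of_classNumber_eq_one [IsTotallyComplex K] (h𝔪 : 𝔪 ≠ ⊥)
    (h1 : classNumber K = 1) :
    ∃ η : (𝓞 K ⧸ 𝔪)ˣ →* RayClassGroup 𝔪, Function.Surjective η ∧
      η.ker = (Units.map (Ideal.Quotient.mk 𝔪).toMonoidHom : (𝓞 K)ˣ →* (𝓞 K ⧸ 𝔪)ˣ).range ∧
      ∀ (x : (𝓞 K ⧸ 𝔪)ˣ) (a : 𝓞 K) (ha : Ideal.span {a} ≠ ⊥ ∧ IsCoprime (Ideal.span {a}) 𝔪),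
        Ideal.Quotient.mk 𝔪 a = x → η x = integralRayClass 𝔪 h𝔪 ⟨Ideal.span {a}, ha⟩ := by
  obtain ⟨f, hf⟩ := exists_toClassGroup (K := K) h𝔪
  obtain ⟨η, hη⟩ := exists_unitsQuot_hom (K := K) h𝔪
  refine ⟨η, ?_, ker_unitsQuot_eq_range h𝔪 η hη, hη⟩
  haveI : Subsingleton (ClassGroup (𝓞 K)) := by
    apply Fintype.card_le_one_iff_subsingleton.mp
    rw [← classNumber, h1]
  rw [← MonoidHom.range_eq_top, ← ker_toClassGroup_eq_range h𝔪 f hf η hη, eq_top_iff]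
  intro c _
  rw [MonoidHom.mem_ker]
  exact Subsingleton.elim _ _

/-! ### §3 `K = ℚ(√-7)`, `2 = v v̄`: `Cl_K^{v^{n+1}}` and `Gal(K(v^{n+1})/K)` are cyclic -/

section Seven

open Literature.NumberTheory.EllipticCurves

variable {K : Type} [Field K] [NumberField K] (hK : IsImaginaryQuadratic K) (hd : NumberField.discr K = -7)
  {v vbar : HeightOneSpectrum (𝓞 K)}
  (hv : ((2 : ℕ) : 𝓞 K) ∈ v.asIdeal) (hvbar : ((2 : ℕ) : 𝓞 K) ∈ vbar.asIdeal) (hne : vbar ≠ v)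
include hK hd hv hvbar hne

/-- ★★ **`Cl_K^{v^{n+1}}` is cyclic** (all `n`) for `K = ℚ(√-7)`, `2 = v v̄`: it is the quotient of
`(𝓞/v^{n+1})ˣ ≅ (ℤ/2^{n+1})ˣ` (`nonempty_ringEquiv_zmod_quotient_pow`) by the global units `±1`, and every
quotient of `(ℤ/2^k)ˣ` killing `-1` is cyclic. [cite: deShalit1987, II.1.9 (p. 43)]
[cite: NeukirchANT1999, Ch. VI §1 Prop. (1.11)] -/
theorem isCyclic_rayClassGroup_pow_succ_of_discr_eq_neg_seven (n : ℕ) :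
    IsCyclic (RayClassGroup (v.asIdeal ^ (n + 1))) := by
  haveI := hK.isTotallyComplex
  haveI : Fact (Nat.Prime 2) := ⟨Nat.prime_two⟩
  have h1 : classNumber K = 1 := by
    have h := natCard_rayClassGroup_eq_classNumber_of_split_two hK.1 hv hvbar hne
    rw [natCard_rayClassGroup_eq_one_of_discr_eq_neg_seven hK hd hv hvbar hne] at h
    exact h.symm
  obtain ⟨η, hsurj, hker, -⟩ :=
    exists_surjective_unitsQuot_hom_of_classNumber_eq_one (pow_ne_zero (n + 1) v.ne_bot) h1
  obtain ⟨e⟩ := nonempty_ringEquiv_zmod_quotient_pow v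
    (Literature.NumberTheory.NumberFields.natCard_quotient_eq_of_mem_of_mem_of_ne hK.1 Nat.prime_two hv hvbar hne)
    (Literature.NumberTheory.NumberFields.intValuation_natCast_eq_of_mem_of_mem_of_ne hK.1 Nat.prime_two hv hvbar
      hne) (n + 1)
  refine ZModTwoPow.isCyclic_of_surjective_of_map_neg_one (η.comp (Units.mapEquiv e.toMulEquiv).toMonoidHom)
    (hsurj.comp (Units.mapEquiv e.toMulEquiv).surjective) ?_
  -- `-1 ↦ -1 ↦ η(-1) = 1` (`-1` is a global unit)
  rw [MonoidHom.comp_apply, ← MonoidHom.mem_ker, hker]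
  refine ⟨-1, Units.ext ?_⟩
  simp

/-- ★★ **`Gal(K(v^{n+1})/K)` is cyclic** (all `n`) for `K = ℚ(√-7)`, `2 = v v̄`, by Artin reciprocity
`Gal(K(v^{n+1})/K) ≅ Cl_K^{v^{n+1}}` (`rayClassField_galEquivRayClassGroup`). [cite: deShalit1987, II.1.9 (p. 43), II.4.6 (p. 59)]
[cite: NeukirchANT1999, Ch. VI §7 Thm. (7.1)] -/
theorem isCyclic_gal_rayClassField_pow_succ_of_discr_eq_neg_seven (n : ℕ) :
    IsCyclic (Literature.NumberTheory.NumberFields.rayClassField K (v.asIdeal ^ (n + 1)) ≃ₐ[K]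
      Literature.NumberTheory.NumberFields.rayClassField K (v.asIdeal ^ (n + 1))) := by
  haveI := hK.isTotallyComplex
  haveI := isCyclic_rayClassGroup_pow_succ_of_discr_eq_neg_seven hK hd hv hvbar hne n
  exact isCyclic_of_surjective _
    (Literature.NumberTheory.NumberFields.rayClassField_galEquivRayClassGroup
      (pow_ne_zero (n + 1) v.ne_bot)).symm.surjective

/-- **`#Gal(K(v^{n+1})/K) = 2^{n-1}`** (`n ≥ 1`) for `K = ℚ(√-7)`, `2 = v v̄` — so `Gal(K(v^{n+1})/K)` is THE
cyclic group of order `2^{n-1}`. [cite: deShalit1987, II.1.9 (p. 43)] -/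
theorem natCard_gal_rayClassField_pow_succ_of_discr_eq_neg_seven {n : ℕ} (hn : 1 ≤ n) :
    Nat.card (Literature.NumberTheory.NumberFields.rayClassField K (v.asIdeal ^ (n + 1)) ≃ₐ[K]
      Literature.NumberTheory.NumberFields.rayClassField K (v.asIdeal ^ (n + 1))) = 2 ^ (n - 1) := by
  haveI := hK.isTotallyComplex
  rw [Nat.card_congr (Literature.NumberTheory.NumberFields.rayClassField_galEquivRayClassGroup
      (pow_ne_zero (n + 1) v.ne_bot)).toEquiv,
    natCard_rayClassGroup_pow_succ_of_discr_eq_neg_seven hK hd hv hvbar hne hn]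

end Seven

end Summit.BirchSwinnertonDyer.BirchSwinnertonDyer.Theorems.PrintCf2.RayClassNumberFormula

end
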